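import Summits.NavierStokesRegularity.NavierStokesRegularity.Theorems.ExtremiserTransienceNearExtremalTransienceExtremiserLiouvilleConstantSpeedBlowDownConcentration
import HarnessLib

/-!
# Crux `ExtremiserTransience.NearExtremalTransience` (stmt-NavierStokesRegularity-21883), line `extremiser_liouville`,
# stub K1b — THE RESIDUE JET IS NOT ASYMPTOTICALLY SELF-SIMILAR (no conical jets)

`--supports stmt-NavierStokesRegularity-21883` (helper).  Author: prover seat `ns-el-k1b` (g6).  A PARTIAL KILL of the jet
alternative.  For a residue jet the excess `u = v − c` has `‖u‖² = 2M(M − v·ĉ)`, energy `2MQ` per unit length (`Q` = flux deficit),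
so `‖u_h‖ ~ δ(z)⁻¹` across a jet of width `δ(z)`; a CONICAL jet (`δ ~ |z|`) is asymptotically homogeneous of degree `−1`:
`u = U + r`, `U(λx) = λ⁻¹U(x)`, `∫_{B_ρ}‖r‖² = o(ρ)`.  For such a far field the blow-downs `R u(R·) = U + R r(R·)` converge STRONGLY
in `L²_loc` to `U`, which is excluded by `blowDown_not_stronglyConvergent` (a strong limit vanishes by the growth Liouville theorem,
yet carries energy `≥ e₀` per unit length).  Hence:

* `no_asymptoticallyHomogeneous_jet` : a K1b residue with two-sided linear excess-energy growth is NOT of the form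
  `v − c = U + r` with `U` measurable and `(−1)`-homogeneous and `R⁻¹∫_{B_{RL}}‖r‖² → 0` for every `L > 0`.

What survives: SUB-conical jets (`δ = o(z)`: blow-downs concentrate on the axis, `…BlowDownWeakLimit`) and SUPER-conical ones
(`δ ≫ z`: the lower growth bound fails).  WHAT THIS IS NOT: K1b is NOT proved; nothing here proves NS regularity. [folklore]
-/

noncomputable section

open Set Filter Topology MeasureTheory Metric Function
open scoped ENNReal NNReal Topology InnerProductSpace RealInnerProductSpace ContDiff
open Literature.Analysis.FluidPDE Literature.Analysis

namespace Summit.NavierStokesRegularity.NavierStokesRegularity.Theorems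

-- the problem directory repeats the summit name (`NavierStokesRegularity/NavierStokesRegularity`)
set_option linter.dupNamespace false

namespace ExtremiserLiouville

open DepletionLadder.KStar DepletionLadder.KStar.HalfSpace

variable {v : E3 → E3} {c : E3}

/-- **No asymptotically self-similar (conical) residue jet.**  Residue `(v, μ)` as in `blowDown_limit_ae_eq_zero` with two-sided
linear excess-energy growth; `U` measurable and homogeneous of degree `−1` (`R·U(Rx) = U(x)`, `R > 0`); if the remainder
`r = v − c − U` satisfies `R⁻¹ ∫⁻_{B_{RL}}‖r‖ₑ² → 0` (`R → ∞`) for every `L > 0`, contradiction.  (K1b itself is NOT proved here.)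
[folklore] -/
theorem no_asymptoticallyHomogeneous_jet (hv : ContDiff ℝ ∞ v) (hdiv : VectorCalculus.IsDivFree v) {M : ℝ}
    (hM : ∀ x, ‖v x‖ = M) (h1 : ∫⁻ x, ‖iteratedFDeriv ℝ 1 v x‖ₑ ^ 2 < ⊤) (h2 : ∫⁻ x, ‖iteratedFDeriv ℝ 2 v x‖ₑ ^ 2 < ⊤)
    (hpos : 0 < M * Real.sqrt (Zen v) * Real.sqrt (Wpa v))
    (μ : Measure E3) [IsFiniteMeasure μ]
    (hμ : ∀ ψ : E3 → E3, ContDiff ℝ ∞ ψ → HasCompactSupport ψ → VectorCalculus.IsDivFree ψ →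
      Jst v * J1 v ψ - kStar ^ 2 * M ^ 2 * (Wpa v * A1 v ψ + Zen v * C1 v ψ) = ∫ x, ⟪v x, ψ x⟫_ℝ ∂μ)
    (hc : c ≠ 0) (hcM : ‖c‖ = M) (hL6 : MemLp (fun x => v x - c) 6 volume)
    {Cg : ℝ} (hCg : 0 ≤ Cg) (hgrowth : ∀ ρ : ℝ, 1 ≤ ρ → ∫⁻ x in ball (0 : E3) ρ, ‖v x - c‖ₑ ^ 2 ≤ ENNReal.ofReal (Cg * ρ))
    {e₀ L₀ : ℝ} (he₀ : 0 < e₀) (hL₀ : 0 < L₀)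
    (hlow : ∀ R : ℝ, 1 ≤ R → ENNReal.ofReal (e₀ * R) ≤ ∫⁻ x in ball (0 : E3) (R * L₀), ‖v x - c‖ₑ ^ 2)
    {U : E3 → E3} (hU : AEStronglyMeasurable U volume) (hhom : ∀ R : ℝ, 0 < R → ∀ x, R • U (R • x) = U x)
    (hrem : ∀ L : ℝ, 0 < L →
      Tendsto (fun R : ℝ => ENNReal.ofReal R⁻¹ * ∫⁻ x in ball (0 : E3) (R * L), ‖v x - c - U x‖ₑ ^ 2) atTop (𝓝 0)) :
    False := by
  -- blow down along `Rₙ = n + 1`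
  set Rn : ℕ → ℝ := fun n => (n : ℝ) + 1 with hRn
  have hRn1 : ∀ n, 1 ≤ Rn n := fun n => by simp only [hRn]; linarith [n.cast_nonneg (α := ℝ)]
  have hRn0 : ∀ n, 0 < Rn n := fun n => one_pos.trans_le (hRn1 n)
  have hRnT : Tendsto Rn atTop atTop := tendsto_atTop_add_const_right _ 1 tendsto_natCast_atTop_atTop
  refine blowDown_not_stronglyConvergent hv hdiv hM h1 h2 hpos μ hμ hc hcM hL6 hCg hgrowth he₀ hL₀ hlow hRn1 hRnT hU
    fun L hL => ?_
  -- `∫⁻_{B_L} ‖Rₙ(v(Rₙx) − c) − U(x)‖ₑ² = Rₙ⁻¹ ∫⁻_{B_{RₙL}} ‖v − c − U‖ₑ²` by homogeneity of `U`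
  have hid : ∀ n, ∫⁻ x in ball (0 : E3) L, ‖Rn n • (v (Rn n • x) - c) - U x‖ₑ ^ 2 =
      ENNReal.ofReal (Rn n)⁻¹ * ∫⁻ x in ball (0 : E3) (Rn n * L), ‖v x - c - U x‖ₑ ^ 2 := by
    intro n
    have h := lintegral_ball_blowDown_sq (fun y => v y - U y) c (hRn0 n) L
    have hpt : ∀ x, Rn n • (v (Rn n • x) - c) - U x = Rn n • ((fun y => v y - U y) (Rn n • x) - c) := by
      intro x
      rw [← hhom (Rn n) (hRn0 n) x]
      simp only [smul_sub]
      abel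
    have hpt' : ∀ x, v x - U x - c = v x - c - U x := fun x => by abel
    simp_rw [hpt, hpt'] at h ⊢
    exact h
  simp_rw [hid]
  exact (hrem L hL).comp hRnT

end ExtremiserLiouville

end Summit.NavierStokesRegularity.NavierStokesRegularity.Theorems

end
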